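import Summits.NavierStokesRegularity.NavierStokesRegularity.Theorems.PoloidalWindowDoorPoloidalWindowRigidityZShockPSystemNonuniform
import HarnessLib

/-!
# Crux K2 `PoloidalWindowRigidity` (stmt-NavierStokesRegularity-19708), line `z_shock` — ★ RUNG R2 UNDER NON-UNIFORM GENUINE
# NONLINEARITY: the two-sided eternal bounded solution of the autonomous p-system is CONSTANT (symmetries + Lemma A)

`--supports stmt-NavierStokesRegularity-19708 --as helper` (leafhand-ns-poloidalwindowdoor-3 g2, cell decomp-ns, 2026-08-31).  Class-free,
Mathlib + tree files only.  **No stub and no summit is closed by this file; Navier–Stokes regularity is NOT proved here (rung 0).**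

`…ZShockPSystemNonuniform.no_pos_forward_gradient` (Lemma A, p823042): under the standing hypotheses (module docstring there) the
forward Riemann invariant has `r_x ≤ 0` everywhere.  The reflection `(z, x) ↦ (−z, −x)` maps solutions to solutions and reverses the
sign of `r_x` (`forward_gradient_nonneg`), so `r_x ≡ 0` (`forward_gradient_eq_zero`); the reflection `x ↦ −x`, `p ↦ −p` maps
solutions to solutions and exchanges the two Riemann invariants, so `s_x ≡ 0` (`backward_gradient_eq_zero`); hence
`w_x = p_x = w_z = p_z = 0` and `(w, p)` is a constant state:

* `pSystem_const_nonuniform` — ★ **R2, NON-UNIFORM FORM, NO RECURRENCE HYPOTHESIS.**  A two-sided (`z ∈ ℝ`) `C²` solution of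
  `p_z = −κ(w)² w_x`, `w_z = −p_x` on `ℝ × ℝ` with `w`, `w_x`, `w_z` bounded, `0 < κlo ≤ κ(w) ≤ κhi` and `|κ'(w)| ≤ k₁` along the
  solution, for a `C¹` speed `κ > 0` with `κ' ≥ 0` continuous and NOT identically zero on any nontrivial interval (i.e. `κ` strictly
  increasing — genuine nonlinearity may DEGENERATE on any closed set of values with empty interior), is constant.  This supersedes the
  uniform theorem `…PSystemLiouvilleAlong.pSystem_const_along` (`κ' ≥ k₀ > 0`) and the conditional `…PSystemLiouvilleDivergent.
  pSystem_const_of_divergent`; the linearly degenerate case (`κ' ≡ 0` on an interval of values) genuinely carries travelling waves, so the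
  hypothesis is sharp.  It is exactly the 1-D shadow «R2 with non-uniform genuine nonlinearity» of the standing repair census of the crux.

[folklore] (Lax 1964; John 1974; Klainerman–Majda 1980; evidence memo `R2-NONUNIFORM-leafhand-3-g2.md` v4 on the crux item)
-/

noncomputable section

namespace Summit.NavierStokesRegularity.NavierStokesRegularity.Theorems.PoloidalWindowDoorPoloidalWindowRigidityZShockPSystemNonuniformConst

-- the summit and its single sub-problem share the name (CONVENTIONS §1)
set_option linter.dupNamespace false

open Set Filter Topology Function
open Summit.NavierStokesRegularity.NavierStokesRegularity.Theorems.PoloidalWindowDoorPoloidalWindowRigidityZShockPSystemNonuniform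

variable {w p : ℝ × ℝ → ℝ} {κ κ' K : ℝ → ℝ} {κlo κhi k₁ W₁ W₂ Mw : ℝ}

/-- **`r_x ≥ 0` everywhere**, by Lemma A for the reflected solution `(w, p) ∘ (−·)` (the point reflection `(z, x) ↦ (−z, −x)` maps
solutions of the p-system to solutions and `r_x` to `−r_x`). [folklore] -/
theorem forward_gradient_nonneg (hw : ContDiff ℝ 2 w) (hp : ContDiff ℝ 2 p)
    (hK2 : ContDiff ℝ 2 K) (hKd : ∀ v, HasDerivAt K (κ v) v) (hκd : ∀ v, HasDerivAt κ (κ' v) v) (hκ'c : Continuous κ')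
    (hsys1 : ∀ q, fderiv ℝ p q (1, 0) = -(κ (w q) ^ 2 * fderiv ℝ w q (0, 1)))
    (hsys2 : ∀ q, fderiv ℝ w q (1, 0) = -fderiv ℝ p q (0, 1))
    (hκlo0 : 0 < κlo) (hκlo : ∀ q, κlo ≤ κ (w q)) (hκhi : ∀ q, κ (w q) ≤ κhi)
    (hκpos : ∀ v, 0 < κ v) (hgnl : ∀ v, 0 ≤ κ' v) (hgn : ∀ a b : ℝ, a < b → ∃ v ∈ Ioo a b, κ' v ≠ 0)
    (hk₁ : ∀ q, |κ' (w q)| ≤ k₁) (hW₁ : ∀ q, |fderiv ℝ w q (0, 1)| ≤ W₁) (hW₂ : ∀ q, |fderiv ℝ w q (1, 0)| ≤ W₂)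
    (hMw : ∀ q, |w q| ≤ Mw) :
    ∀ q : ℝ × ℝ, 0 ≤ fderiv ℝ p q (0, 1) + κ (w q) * fderiv ℝ w q (0, 1) := by
  have hw1 : Differentiable ℝ w := hw.differentiable (by simp)
  have hp1 : Differentiable ℝ p := hp.differentiable (by simp)
  -- the reflected pair
  set w' : ℝ × ℝ → ℝ := fun q => w (-q) with hw'
  set p' : ℝ × ℝ → ℝ := fun q => p (-q) with hp'
  have hw'2 : ContDiff ℝ 2 w' := hw.comp contDiff_neg
  have hp'2 : ContDiff ℝ 2 p' := hp.comp contDiff_neg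
  have hw'D : ∀ q v, fderiv ℝ w' q v = -fderiv ℝ w (-q) v := by
    intro q v
    have h := ((hw1 (-q)).hasFDerivAt.comp q ((hasFDerivAt_id q).neg)).fderiv
    rw [show w' = w ∘ Neg.neg from rfl, h]
    simp
  have hp'D : ∀ q v, fderiv ℝ p' q v = -fderiv ℝ p (-q) v := by
    intro q v
    have h := ((hp1 (-q)).hasFDerivAt.comp q ((hasFDerivAt_id q).neg)).fderiv
    rw [show p' = p ∘ Neg.neg from rfl, h]
    simp
  have hsys1' : ∀ q, fderiv ℝ p' q (1, 0) = -(κ (w' q) ^ 2 * fderiv ℝ w' q (0, 1)) := by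
    intro q; rw [hp'D, hw'D, hsys1]; ring
  have hsys2' : ∀ q, fderiv ℝ w' q (1, 0) = -fderiv ℝ p' q (0, 1) := by
    intro q; rw [hw'D, hp'D, hsys2]
  have h := no_pos_forward_gradient hw'2 hp'2 hK2 hKd hκd hκ'c hsys1' hsys2' hκlo0 (fun q => hκlo (-q))
    (fun q => hκhi (-q)) hκpos hgnl hgn (fun q => hk₁ (-q))
    (fun q => by rw [hw'D, abs_neg]; exact hW₁ (-q)) (fun q => by rw [hw'D, abs_neg]; exact hW₂ (-q))
    (fun q => hMw (-q))
  intro q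
  have hq := h (-q)
  rw [hp'D, hw'D, neg_neg] at hq
  simp only [hw', neg_neg] at hq
  linarith

/-- **`r_x ≡ 0`** (Lemma A and `forward_gradient_nonneg`). [folklore] -/
theorem forward_gradient_eq_zero (hw : ContDiff ℝ 2 w) (hp : ContDiff ℝ 2 p)
    (hK2 : ContDiff ℝ 2 K) (hKd : ∀ v, HasDerivAt K (κ v) v) (hκd : ∀ v, HasDerivAt κ (κ' v) v) (hκ'c : Continuous κ')
    (hsys1 : ∀ q, fderiv ℝ p q (1, 0) = -(κ (w q) ^ 2 * fderiv ℝ w q (0, 1)))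
    (hsys2 : ∀ q, fderiv ℝ w q (1, 0) = -fderiv ℝ p q (0, 1))
    (hκlo0 : 0 < κlo) (hκlo : ∀ q, κlo ≤ κ (w q)) (hκhi : ∀ q, κ (w q) ≤ κhi)
    (hκpos : ∀ v, 0 < κ v) (hgnl : ∀ v, 0 ≤ κ' v) (hgn : ∀ a b : ℝ, a < b → ∃ v ∈ Ioo a b, κ' v ≠ 0)
    (hk₁ : ∀ q, |κ' (w q)| ≤ k₁) (hW₁ : ∀ q, |fderiv ℝ w q (0, 1)| ≤ W₁) (hW₂ : ∀ q, |fderiv ℝ w q (1, 0)| ≤ W₂)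
    (hMw : ∀ q, |w q| ≤ Mw) :
    ∀ q : ℝ × ℝ, fderiv ℝ p q (0, 1) + κ (w q) * fderiv ℝ w q (0, 1) = 0 := fun q =>
  le_antisymm (no_pos_forward_gradient hw hp hK2 hKd hκd hκ'c hsys1 hsys2 hκlo0 hκlo hκhi hκpos hgnl hgn hk₁ hW₁ hW₂ hMw q)
    (forward_gradient_nonneg hw hp hK2 hKd hκd hκ'c hsys1 hsys2 hκlo0 hκlo hκhi hκpos hgnl hgn hk₁ hW₁ hW₂ hMw q)

/-- **`s_x ≡ 0`**, by `forward_gradient_eq_zero` for the reflected solution `(w(z, −x), −p(z, −x))` (the reflection `x ↦ −x`,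
`p ↦ −p` maps solutions to solutions and exchanges the Riemann invariants: `r̃_x(z, x) = s_x(z, −x)`). [folklore] -/
theorem backward_gradient_eq_zero (hw : ContDiff ℝ 2 w) (hp : ContDiff ℝ 2 p)
    (hK2 : ContDiff ℝ 2 K) (hKd : ∀ v, HasDerivAt K (κ v) v) (hκd : ∀ v, HasDerivAt κ (κ' v) v) (hκ'c : Continuous κ')
    (hsys1 : ∀ q, fderiv ℝ p q (1, 0) = -(κ (w q) ^ 2 * fderiv ℝ w q (0, 1)))
    (hsys2 : ∀ q, fderiv ℝ w q (1, 0) = -fderiv ℝ p q (0, 1))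
    (hκlo0 : 0 < κlo) (hκlo : ∀ q, κlo ≤ κ (w q)) (hκhi : ∀ q, κ (w q) ≤ κhi)
    (hκpos : ∀ v, 0 < κ v) (hgnl : ∀ v, 0 ≤ κ' v) (hgn : ∀ a b : ℝ, a < b → ∃ v ∈ Ioo a b, κ' v ≠ 0)
    (hk₁ : ∀ q, |κ' (w q)| ≤ k₁) (hW₁ : ∀ q, |fderiv ℝ w q (0, 1)| ≤ W₁) (hW₂ : ∀ q, |fderiv ℝ w q (1, 0)| ≤ W₂)
    (hMw : ∀ q, |w q| ≤ Mw) :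
    ∀ q : ℝ × ℝ, fderiv ℝ p q (0, 1) - κ (w q) * fderiv ℝ w q (0, 1) = 0 := by
  have hw1 : Differentiable ℝ w := hw.differentiable (by simp)
  have hp1 : Differentiable ℝ p := hp.differentiable (by simp)
  -- the reflection `R (z, x) = (z, -x)`
  set R : ℝ × ℝ → ℝ × ℝ := fun q => (q.1, -q.2) with hR
  set R' : ℝ × ℝ →L[ℝ] ℝ × ℝ := (ContinuousLinearMap.fst ℝ ℝ ℝ).prod (-(ContinuousLinearMap.snd ℝ ℝ ℝ)) with hR'
  have hRd : ∀ q, HasFDerivAt R R' q := fun q => hasFDerivAt_fst.prodMk hasFDerivAt_snd.neg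
  have hRc : ContDiff ℝ 2 R := contDiff_fst.prodMk contDiff_snd.neg
  have hR10 : R' (1, 0) = (1, 0) := by simp [hR']
  have hR01 : R' (0, 1) = -(0, 1) := by simp [hR']
  set w' : ℝ × ℝ → ℝ := fun q => w (R q) with hw'
  set p' : ℝ × ℝ → ℝ := fun q => -p (R q) with hp'
  have hw'2 : ContDiff ℝ 2 w' := hw.comp hRc
  have hp'2 : ContDiff ℝ 2 p' := (hp.comp hRc).neg
  have hw'D : ∀ q v, fderiv ℝ w' q v = fderiv ℝ w (R q) (R' v) := by
    intro q v
    have h := ((hw1 (R q)).hasFDerivAt.comp q (hRd q)).fderiv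
    rw [show w' = w ∘ R from rfl, h]
    simp
  have hp'D : ∀ q v, fderiv ℝ p' q v = -fderiv ℝ p (R q) (R' v) := by
    intro q v
    have h := ((hp1 (R q)).hasFDerivAt.comp q (hRd q)).neg.fderiv
    rw [show p' = -(p ∘ R) from rfl, h]
    simp
  have hsys1' : ∀ q, fderiv ℝ p' q (1, 0) = -(κ (w' q) ^ 2 * fderiv ℝ w' q (0, 1)) := by
    intro q; rw [hp'D, hw'D, hR10, hR01, map_neg, hsys1]; ring
  have hsys2' : ∀ q, fderiv ℝ w' q (1, 0) = -fderiv ℝ p' q (0, 1) := by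
    intro q; rw [hw'D, hp'D, hR10, hR01, map_neg, hsys2]; ring
  have h := forward_gradient_eq_zero hw'2 hp'2 hK2 hKd hκd hκ'c hsys1' hsys2' hκlo0 (fun q => hκlo (R q))
    (fun q => hκhi (R q)) hκpos hgnl hgn (fun q => hk₁ (R q))
    (fun q => by rw [hw'D, hR01, map_neg, abs_neg]; exact hW₁ (R q))
    (fun q => by rw [hw'D, hR10]; exact hW₂ (R q)) (fun q => hMw (R q))
  intro q
  have hq := h (R q)
  have hRR : R (R q) = q := by simp [hR]
  rw [hp'D, hw'D, hR01, map_neg, map_neg, hRR] at hq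
  simp only [hw', hRR] at hq
  linarith

/-- **★ R2 under non-uniform genuine nonlinearity: the solution is a constant state.**  See the module docstring for the hypotheses;
no uniform lower bound on `κ'` and no recurrence hypothesis is assumed. [folklore] -/
theorem pSystem_const_nonuniform (hw : ContDiff ℝ 2 w) (hp : ContDiff ℝ 2 p)
    (hK2 : ContDiff ℝ 2 K) (hKd : ∀ v, HasDerivAt K (κ v) v) (hκd : ∀ v, HasDerivAt κ (κ' v) v) (hκ'c : Continuous κ')
    (hsys1 : ∀ q, fderiv ℝ p q (1, 0) = -(κ (w q) ^ 2 * fderiv ℝ w q (0, 1)))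
    (hsys2 : ∀ q, fderiv ℝ w q (1, 0) = -fderiv ℝ p q (0, 1))
    (hκlo0 : 0 < κlo) (hκlo : ∀ q, κlo ≤ κ (w q)) (hκhi : ∀ q, κ (w q) ≤ κhi)
    (hκpos : ∀ v, 0 < κ v) (hgnl : ∀ v, 0 ≤ κ' v) (hgn : ∀ a b : ℝ, a < b → ∃ v ∈ Ioo a b, κ' v ≠ 0)
    (hk₁ : ∀ q, |κ' (w q)| ≤ k₁) (hW₁ : ∀ q, |fderiv ℝ w q (0, 1)| ≤ W₁) (hW₂ : ∀ q, |fderiv ℝ w q (1, 0)| ≤ W₂)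
    (hMw : ∀ q, |w q| ≤ Mw) :
    ∀ q q' : ℝ × ℝ, w q = w q' ∧ p q = p q' := by
  have hw1 : Differentiable ℝ w := hw.differentiable (by simp)
  have hp1 : Differentiable ℝ p := hp.differentiable (by simp)
  have hr := forward_gradient_eq_zero hw hp hK2 hKd hκd hκ'c hsys1 hsys2 hκlo0 hκlo hκhi hκpos hgnl hgn hk₁ hW₁ hW₂ hMw
  have hs := backward_gradient_eq_zero hw hp hK2 hKd hκd hκ'c hsys1 hsys2 hκlo0 hκlo hκhi hκpos hgnl hgn hk₁ hW₁ hW₂ hMw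
  have hall : ∀ q, fderiv ℝ w q (0, 1) = 0 ∧ fderiv ℝ p q (0, 1) = 0 ∧ fderiv ℝ w q (1, 0) = 0 ∧ fderiv ℝ p q (1, 0) = 0 := by
    intro q
    have h1 := hr q
    have h2 := hs q
    have hκne : κ (w q) ≠ 0 := (hκlo0.trans_le (hκlo q)).ne'
    have hwx : fderiv ℝ w q (0, 1) = 0 := by
      have : 2 * κ (w q) * fderiv ℝ w q (0, 1) = 0 := by linear_combination h1 - h2
      rcases mul_eq_zero.1 this with h | h
      · exact absurd h (mul_ne_zero two_ne_zero hκne)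
      · exact h
    have hpx : fderiv ℝ p q (0, 1) = 0 := by linear_combination (h1 + h2) / 2
    refine ⟨hwx, hpx, ?_, ?_⟩
    · rw [hsys2, hpx, neg_zero]
    · rw [hsys1, hwx, mul_zero, neg_zero]
  have hDw : ∀ q, fderiv ℝ w q = 0 := fun q => by
    refine ContinuousLinearMap.ext fun v => ?_
    obtain ⟨a, b⟩ := v
    rw [Literature.Geometry.Riemannian.clm_prod_apply_eq, (hall q).1, (hall q).2.2.1]
    simp
  have hDp : ∀ q, fderiv ℝ p q = 0 := fun q => by
    refine ContinuousLinearMap.ext fun v => ?_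
    obtain ⟨a, b⟩ := v
    rw [Literature.Geometry.Riemannian.clm_prod_apply_eq, (hall q).2.1, (hall q).2.2.2]
    simp
  intro q q'
  exact ⟨is_const_of_fderiv_eq_zero hw1 hDw q q', is_const_of_fderiv_eq_zero hp1 hDp q q'⟩

end Summit.NavierStokesRegularity.NavierStokesRegularity.Theorems.PoloidalWindowDoorPoloidalWindowRigidityZShockPSystemNonuniformConst

end
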